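import Summits.ResolutionOfSingularities.ResolutionOfSingularities.Theorems.HomologicalConductorNoZenoTraceSocleTerminator
import Summits.ResolutionOfSingularities.ResolutionOfSingularities.Theorems.HomologicalConductorNoZenoCoarseningLU
import Summits.ResolutionOfSingularities.ResolutionOfSingularities.Theorems.HomologicalConductorStrictDropTowerShape
import Literature.AlgebraicGeometry.Resolution.TranscendenceDefect
import Literature.AlgebraicGeometry.Resolution.FieldsJ2
import HarnessLib

/-!
# Crux `NoZenoR` / `NoZeno` (stmt-ResolutionOfSingularities-19943 / -16483), β1ʳ¹♯ layer:
# GENERIC-FIBRE STAGES (port of ideator res-L0-w44-idea-1's card 12 `generic-fibre-ladder`, Sketch r13 §r13.2, §r13.3 supply)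

`[OURS · L W4.4]` Cell res-hironaka, crux chain W4.4.  Tree port (seat res-L0-w44-stub-1 g9, CHAIN v23 row stub-1 /
plan-1 (ρ37i) «HOIST idea-1 card 12's PROVED theorems») of `L/res-L0-w44-idea-1/Sketch-idea-1-r13.lean` (sha16
`1301e7a2059ff799`, farm rc 0 · 0 sorries), AUTHOR res-L0-w44-idea-1 g13 (technique A: value-group monotonicity /
rank-one coarsening); statements and proofs are the ideator's, re-homed under `…Theorems.NoZeno.GenericFibreStage`;
the folklore ground-field lemmas are taken from the tree (`CoarseningLU.transcendental_of_residuallyTranscendental`,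
`CoarseningLU.adjoin_simple_le`, `CoarseningLU.one_le_trdeg_adjoin_simple`, `trdeg_lt_aleph0_of_fg`).  Nothing here is
a statement of the manuscript under review (Hironaka 2017); AI-written, weaker than expert review; support-level,
counted 0.  Companion file: `…NoZenoNoetherianCapture` (§r13.1 THM NC, the terminator that consumes these rings).

THE LEVER (ideator's words, abridged).  In branch (b) of β1ʳ¹♯ the unreachable `t ∈ O` is RESIDUALLY
TRANSCENDENTAL: every non-zero polynomial in `t` over `k` is an `O`-unit, so the rational function field `k⟮t⟯`
lies in `O`.  Over the enlarged ground field `k⟮t⟯` the datum `(O, k⟮t⟯[generators])` has transcendence degree ONE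
LESS, and the induction hypothesis that β1ʳ¹♯ carries as a binder (`IH`, all data of smaller transcendence degree,
over every field of characteristic `p`, terminate) APPLIES: for every stage `T_m` there is a REGULAR local ring `D`
(a stage of the `k⟮t⟯`-tower — geometrically the local ring of the GENERIC FIBRE of the pencil `t` over the centre)
with `T_m ≤ D ≤ O`, `k⟮t⟯ ⊆ D`, and `D` dominated by `O`.

* `trdeg_adjoin_simple_lt` — `tr.deg_{k⟮t⟯} K < tr.deg_k K` for `t` transcendental, `tr.deg_k K < ℵ₀`.
* `exists_regular_genericFibreStage` (§r13.2, THM GF; fact-free) and `genericFibre_supply` (§r13.3: the same at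
  the registry binders of β1ʳ¹♯'s branch (b) — only `hk, hA, hfr, hAO, IH` and the branch witness are used).

Compare the tree's `NoZeno.Birth.exists_regular_of_residually_transcendental_mem_tower_of_IH`
(`…NoZenoRebaseInduction`): there the residually transcendental element lies IN a stage and the whole tower re-bases
to `k(s)`; here `t ∈ O` is NOT in any stage, and only a regular OVERRING of each stage inside `O` is produced.

References: O. Zariski (1939) / S. Abhyankar (1956), ground-field enlargement by a residually transcendental element
[folklore]; additivity of transcendence degree in towers (Mathlib `Algebra.trdeg_add_eq`, stacks 030H).
-/

noncomputable section

-- single-problem summit: the doubled namespace component `ResolutionOfSingularities` is forced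
set_option linter.dupNamespace false

namespace Summit.ResolutionOfSingularities.ResolutionOfSingularities.Theorems.NoZeno.GenericFibreStage

open Summit.ResolutionOfSingularities.ResolutionOfSingularities.Theses.HomologicalConductor
open Summit.ResolutionOfSingularities.ResolutionOfSingularities.Theorems.NoZeno.Birth
open Summit.ResolutionOfSingularities.ResolutionOfSingularities.Theorems
open Summit.ResolutionOfSingularities.ResolutionOfSingularities.Theorems.NoZeno
open Literature.AlgebraicGeometry.Resolution
open IsLocalRing Polynomial
open scoped IntermediateField

variable {k K : Type} [Field k] [Field K] [Algebra k K]

/-! ## Transcendence degree over `k⟮t⟯` -/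

/-- **`tr.deg` DROPS over `k⟮t⟯`**: `tr.deg_{k⟮t⟯} K < tr.deg_k K` for `t` transcendental over `k` and
`tr.deg_k K < ℵ₀`. [folklore; additivity in towers, Mathlib `Algebra.trdeg_add_eq` (stacks 030H)] -/
theorem trdeg_adjoin_simple_lt {t : K} (hw : Transcendental k t)
    (hfin : Algebra.trdeg k K < Cardinal.aleph0) : Algebra.trdeg (↥k⟮t⟯) K < Algebra.trdeg k K := by
  have hadd := trdeg_add_eq k (↥k⟮t⟯) (A := K)
  have h1 : 1 ≤ Algebra.trdeg k (↥k⟮t⟯) := CoarseningLU.one_le_trdeg_adjoin_simple hw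
  rw [← hadd] at hfin ⊢
  obtain ⟨a, ha⟩ := Cardinal.lt_aleph0.mp (lt_of_le_of_lt le_self_add hfin)
  obtain ⟨b, hb⟩ := Cardinal.lt_aleph0.mp (lt_of_le_of_lt le_add_self hfin)
  rw [ha] at h1
  rw [ha, hb]
  have h1' : 1 ≤ a := by exact_mod_cast h1
  have : b < a + b := by omega
  exact_mod_cast this

/-- `tr.deg_k K < ℵ₀` for `K = Frac A`, `A` a finitely generated `k`-subalgebra of `K`.
[folklore; tree `IntermediateField.fg_top_of_isFractionRing_of_finiteType` + `trdeg_lt_aleph0_of_fg`] -/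
theorem trdeg_lt_aleph0_of_subalgebra_fg (A : Subalgebra k K) (hA : A.FG) (hfr : IsFractionRing ↥A K) :
    Algebra.trdeg k K < Cardinal.aleph0 := by
  haveI := hfr
  haveI : Algebra.FiniteType k ↥A := A.fg_iff_finiteType.mp hA
  exact trdeg_lt_aleph0_of_fg (IntermediateField.fg_top_of_isFractionRing_of_finiteType k ↥A K)

/-! ## §r13.2 GENERIC-FIBRE STAGES: in branch (b) the induction hypothesis applies over `k⟮t⟯` -/

/-- **GENERIC-FIBRE STAGES (THM GF; fact-free).**  For a datum `(O, A)` of the canonical normalised `ca`-tower, a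
RESIDUALLY TRANSCENDENTAL `t ∈ O` (no non-zero polynomial in `t` over `k` has positive value), the induction
hypothesis `IH` (termination for all data of smaller transcendence degree over every field of characteristic `p`)
and every stage `T_m`: there is a REGULAR local `k`-subalgebra `D` with `T_m ≤ D ≤ O`, `k⟮t⟯ ⊆ D`, and `D`
DOMINATED by `O` (its `O`-units are units) — a regular stage of the `k⟮t⟯`-tower of `(O, k⟮t⟯[generators of A and
of a model of T_m])`.  Geometrically: `D` is the local ring of a regular point of the generic fibre of the pencil
`t`, through which the given stage factors.  Proof: `k⟮t⟯ ⊆ O` (tree `CoarseningLU.adjoin_simple_le`); `T_m = loc O B`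
with `B` finitely generated (tree `StrictDrop.Birth.TowerShape.stub_towerShape`); `A' := k⟮t⟯[S_A ∪ S_B]` is a finitely
generated `k⟮t⟯`-model of `K` inside `O`; `tr.deg_{k⟮t⟯} K < tr.deg_k K` (`trdeg_adjoin_simple_lt`); `IH` gives a
regular stage `tower O A' M ⊇ loc O B = T_m`. [OURS: ideator res-L0-w44-idea-1, Sketch r13 §r13.2] -/
theorem exists_regular_genericFibreStage (p : ℕ) (hp : p.Prime) (k K : Type) [Field k] [CharP k p]
    [Field K] [Algebra k K] (O : ValuationSubring K) (A : Subalgebra k K)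
    (hk : ∀ c : k, algebraMap k K c ∈ O) (hA : A.FG) (hfr : IsFractionRing ↥A K)
    (hAO : A.toSubring ≤ O.toSubring)
    (IH : ∀ (k' K' : Type) [Field k'] [CharP k' p] [Field K'] [Algebra k' K'] (O' : ValuationSubring K')
      (A' : Subalgebra k' K'), (∀ c : k', algebraMap k' K' c ∈ O') → A'.FG → IsFractionRing ↥A' K' →
      A'.toSubring ≤ O'.toSubring → Algebra.trdeg k' K' < Algebra.trdeg k K →
      ∃ m : ℕ, IsRegularLocalRing ↥(tower O' A' m))
    {t : K} (htO : t ∈ O) (ht : ∀ f : k[X], f ≠ 0 → ¬ O.valuation (aeval t f) < 1) (m : ℕ) :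
    ∃ D : Subalgebra k K, IsRegularLocalRing ↥D ∧ tower O A m ≤ D ∧ D.toSubring ≤ O.toSubring ∧
      (∀ x : K, x ∈ k⟮t⟯ → x ∈ D) ∧ (∀ x ∈ D, x⁻¹ ∈ O → x⁻¹ ∈ D) := by
  classical
  haveI := hfr
  have htr_t : Transcendental k t := CoarseningLU.transcendental_of_residuallyTranscendental O ht
  have hFO : ∀ x : K, x ∈ k⟮t⟯ → x ∈ O := fun x hx => CoarseningLU.adjoin_simple_le O htO ht hk hx
  set F : IntermediateField k K := k⟮t⟯ with hFdef
  haveI : CharP (↥F) p := charP_of_injective_algebraMap (algebraMap k (↥F)).injective p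
  have hkF : ∀ c : ↥F, algebraMap (↥F) K c ∈ O := fun c => hFO c c.2
  -- a finitely generated presentation of the stage `T_m`
  have hshape : (∃ B : Subalgebra k K, B.FG ∧ B ≤ tower O A m ∧
      loc O B = tower O A m ∧ ∀ x ∈ tower O A m, ∃ b ∈ B, ∃ s ∈ B, s⁻¹ ∈ O ∧ x = b * s⁻¹) ∧
      IsNoetherianRing ↥(tower O A m) ∧ (tower O A m).toSubring ≤ O.toSubring ∧
      ∀ s ∈ tower O A m, s⁻¹ ∈ O → s⁻¹ ∈ tower O A m :=
    StrictDrop.Birth.TowerShape.stub_towerShape p hp k K O A hk hA hfr hAO m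
  obtain ⟨⟨B, hBfg, hBT, -, hfrac⟩, -, hTO, -⟩ := hshape
  obtain ⟨SB, hSB⟩ := hBfg
  obtain ⟨SA, hSA⟩ := id hA
  have hSAA : (SA : Set K) ⊆ A := by rw [← hSA]; exact Algebra.subset_adjoin
  have hSBB : (SB : Set K) ⊆ B := by rw [← hSB]; exact Algebra.subset_adjoin
  -- the `k⟮t⟯`-model `A' = k⟮t⟯[SA ∪ SB]`
  let A' : Subalgebra (↥F) K := Algebra.adjoin (↥F) ((SA ∪ SB : Finset K) : Set K)
  have hA'fg : A'.FG := Subalgebra.fg_adjoin_finset _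
  have hgen : ∀ x : K, x ∈ ((SA ∪ SB : Finset K) : Set K) → x ∈ A' := fun x hx => Algebra.subset_adjoin hx
  have hAA' : ∀ x : K, x ∈ A → x ∈ A' := by
    have h : A ≤ A'.restrictScalars k := by
      rw [← hSA]
      refine Algebra.adjoin_le fun y hy => ?_
      rw [Subalgebra.coe_restrictScalars]
      exact hgen y (by simp only [Finset.coe_union, Set.mem_union, Finset.mem_coe] at hy ⊢; exact Or.inl hy)
    exact fun x hx => (Subalgebra.mem_restrictScalars k).mp (h hx)
  have hBA' : ∀ x : K, x ∈ B → x ∈ A' := by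
    have h : B ≤ A'.restrictScalars k := by
      rw [← hSB]
      refine Algebra.adjoin_le fun y hy => ?_
      rw [Subalgebra.coe_restrictScalars]
      exact hgen y (by simp only [Finset.coe_union, Set.mem_union, Finset.mem_coe] at hy ⊢; exact Or.inr hy)
    exact fun x hx => (Subalgebra.mem_restrictScalars k).mp (h hx)
  have hA'O : A'.toSubring ≤ O.toSubring := by
    refine SyzygyFlattening.adjoin_toSubring_le_valuationSubring O hkF fun x hx => ?_
    simp only [Finset.coe_union, Set.mem_union, Finset.mem_coe] at hx
    rcases hx with hx | hx
    · exact hAO (hSAA (Finset.mem_coe.mpr hx))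
    · exact hTO (hBT (hSBB (Finset.mem_coe.mpr hx)))
  have hA'fr : IsFractionRing ↥A' K := by
    refine IsFractionRing.of_field ↥A' K fun z => ?_
    obtain ⟨a, b, -, rfl⟩ := IsFractionRing.div_surjective (A := ↥A) z
    exact ⟨⟨a, hAA' a a.2⟩, ⟨b, hAA' b b.2⟩, rfl⟩
  -- the transcendence degree drops by one
  have htr' : Algebra.trdeg (↥F) K < Algebra.trdeg k K :=
    trdeg_adjoin_simple_lt htr_t (trdeg_lt_aleph0_of_subalgebra_fg A hA hfr)
  -- the induction hypothesis over `k⟮t⟯`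
  obtain ⟨M, hM⟩ := IH (↥F) K O A' hkF hA'fg hA'fr hA'O htr'
  refine ⟨(tower O A' M).restrictScalars k, ?_, ?_, ?_, ?_, ?_⟩
  · exact hM
  · intro x hx
    rw [Subalgebra.mem_restrictScalars]
    obtain ⟨b, hb, s, hs, hsO, rfl⟩ := hfrac x hx
    exact (tower O A' M).mul_mem (mem_tower_of_mem O A' M b (hBA' b hb))
      (TraceSocle.inv_mem_stage O A' hkF hA'O M s (mem_tower_of_mem O A' M s (hBA' s hs)) hsO)
  · intro x hx
    exact TraceSocle.stage_le O A' hkF hA'O M x ((Subalgebra.mem_restrictScalars k).mp hx)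
  · intro x hx
    rw [Subalgebra.mem_restrictScalars]
    exact (tower O A' M).algebraMap_mem (⟨x, hx⟩ : ↥F)
  · intro x hx hxO
    rw [Subalgebra.mem_restrictScalars] at hx ⊢
    exact TraceSocle.inv_mem_stage O A' hkF hA'O M x hx hxO

/-! ## §r13.3 The supply at the registry binders of β1ʳ¹♯'s branch (b) -/

/-- **GENERIC-FIBRE SUPPLY at the registry binders (fact-free).**  On branch (b) of β1ʳ¹♯ — an unreachable,
residually transcendental `t ∈ O` — above EVERY stage there is a regular (hence noetherian) local `k`-subalgebra `D`
of `O`, dominated by `O`, containing `k⟮t⟯` for such a `t`: the candidates for the capturing ring of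
`NoetherianCapture.terminates_of_noetherianCapture_subalgebra`.  Only the binders `hk, hA, hfr, hAO, IH` and the
branch-(b) witness are used. [OURS: ideator res-L0-w44-idea-1, Sketch r13 §r13.3 `genericFibre_supply`] -/
theorem genericFibre_supply (p : ℕ) (hp : p.Prime) (k K : Type) [Field k] [CharP k p] [Field K]
    [Algebra k K] (O : ValuationSubring K) (A : Subalgebra k K) (hk : ∀ c : k, algebraMap k K c ∈ O)
    (hA : A.FG) (hfr : IsFractionRing ↥A K) (hAO : A.toSubring ≤ O.toSubring)
    (IH : ∀ (k' K' : Type) [Field k'] [CharP k' p] [Field K'] [Algebra k' K'] (O' : ValuationSubring K')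
      (A' : Subalgebra k' K'), (∀ c : k', algebraMap k' K' c ∈ O') → A'.FG → IsFractionRing ↥A' K' →
      A'.toSubring ≤ O'.toSubring → Algebra.trdeg k' K' < Algebra.trdeg k K →
      ∃ m : ℕ, IsRegularLocalRing ↥(tower O' A' m))
    (hb : ∃ t : K, t ∈ O ∧ (∀ m : ℕ, t ∉ tower O A m) ∧
      ∀ f : Polynomial k, f ≠ 0 → ¬ O.valuation (Polynomial.aeval t f) < 1) (m : ℕ) :
    ∃ D : Subalgebra k K, IsRegularLocalRing ↥D ∧ IsNoetherianRing ↥D ∧ tower O A m ≤ D ∧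
      D.toSubring ≤ O.toSubring ∧ (∀ x ∈ D, x⁻¹ ∈ O → x⁻¹ ∈ D) ∧
      ∃ t : K, (∀ n : ℕ, t ∉ tower O A n) ∧ ∀ x : K, x ∈ k⟮t⟯ → x ∈ D := by
  obtain ⟨t, htO, htT, ht⟩ := hb
  obtain ⟨D, hreg, hTD, hDO, hFD, hdom⟩ :=
    exists_regular_genericFibreStage p hp k K O A hk hA hfr hAO IH htO ht m
  haveI := hreg
  exact ⟨D, hreg, inferInstance, hTD, hDO, hdom, t, htT, hFD⟩

/-- **The generic-fibre ring is NOT a stage** (it contains the unreachable `t`), although it contains `T_m` and is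
dominated by `O`: on branch (b) the tower threads an infinite family of regular local overrings inside `O` without
ever reaching one. [OURS: reading of Sketch r13 §r13.2–§r13.3] -/
theorem genericFibreStage_ne_tower {O : ValuationSubring K} {A : Subalgebra k K} {D : Subalgebra k K} {t : K}
    (htT : ∀ n : ℕ, t ∉ tower O A n) (htD : ∀ x : K, x ∈ k⟮t⟯ → x ∈ D) (n : ℕ) : D ≠ tower O A n := by
  rintro rfl
  exact htT n (htD t (IntermediateField.mem_adjoin_simple_self k t))

end Summit.ResolutionOfSingularities.ResolutionOfSingularities.Theorems.NoZeno.GenericFibreStage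

end
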